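/-
Copyright (c) 2026 the pub-hodgecm-mathlib formalisation cell (harness21).  Track B «K2-LIT» prover seat hodgecm-mathlib-K2E3-p21 (g0); chair K2-lead (g0), dealer
K2E3-plan (g0) (SIGS-TABLE-K2E3 row #21, chair line REQUESTS l.72411); junction OWNER Track A LH4 «(D-RAM) FOUR-FRAME» (the wild tree U0, all seven stubs ★).  2026-09-03.
-/
import Summits.HodgeConjecture.HodgeConjecture.Theorems.F0P3cStCharTSEPGlueGRamifiedCore  -- ★ (G3)-RAM FILE A: §0 (T1) at ANY uniformiser, §1 the `(q+1, q+1)` sign; brings ★ (G3)'s kit (GLUE, levels, (T2)-RAM, THEOREM C₃ `…_of_transitive`)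
import Summits.HodgeConjecture.HodgeConjecture.Theorems.F0P3cDyRamWildPlaceDatum          -- ★ p8546xx (LH4-p02): `exists_isRamifiedQuadraticDatum_of_placesOver` (the ramified quadratic datum at a CM place, any uniformiser)
import Summits.HodgeConjecture.HodgeConjecture.Theorems.F0P3cDyRamWildTransitivity        -- ★ p854580 (LH4-p02): `htr₂_of_isRamifiedQuadraticDatum` (type-two transitivity at the datum); brings ★ htr₀-WILD p854568
import Literature.NumberTheory.Automorphic.UnitaryLatticeTreeEulerRelationWild            -- ★ p854681 (LH4-p01): `fixedSet_subtree_of_isRamifiedQuadraticDatum` (EULER-G-WILD); brings ★ p854659 `flagTransitive_of_isRamifiedQuadraticDatum`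
import Literature.NumberTheory.Automorphic.UnitaryLatticeTreeLevelIndicesWild             -- ★ p854731 (LH4-p01): `index_inf_subgroupOf_eq_of_isRamifiedQuadraticDatum` (the local index `(q+1, q+1)` of the wild tree)
import HarnessLib

/-!
# K2 · E3 · U5-a — file `K2E3EPFunctionGWild`: KOTTWITZ'S EULER–POINCARÉ FUNCTION ON `G_v = U(Φ₃)(L⁺_v)` AT A WILD (DYADIC RAMIFIED) PLACE
# [Kottwitz1988 §2 Thm. 2; Rogawski1990 §12.6 p. 187; Tits1979 §2.7 (the ramified quasi-split `²A₂`: both vertices special, local index `(q+1, q+1)`)]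

Cell `pub/hodgecm-mathlib` (D-0151), Track B «K2-LIT», crux H413 = `stmt-HodgeConjecture-24833` (lane `--kind proof --supports … --as helper`), route of record
`HCCMUnconditional`; seat K2E3-p21 (g0).  THEOREMS ONLY (no definition ∕ instance ∕ notation ∕ named fact ∕ `sorry`); ★-only imports (never a `Cruxes/…/Lines` module).

SOCKET PAID BY NAME.  `sig_K2E3EPFunctionGWild` of `Cruxes/H413/Lines/K2_E3_EllipticInputsSigs_U5EPU6HSide.lean` (:45, K2E3-plan (g0), sha16 af2003715c66d2bb): the ∀-form of
★ `F0P3cStCharTSEPGlueGRamified.exists_epFunction_G_of_ramified` (tame: `|2|_w = 1`) with the single hypothesis `h2w` replaced by `Valued.v (2 : L_w) < 1`, conclusion bytes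
identical (eight clauses, in order).  The statement below is the socket's bytes with the Lines-side `abbrev Pl L := HeightOneSpectrum (𝓞 L⁺)` inlined (the tie
`sig_K2E3EPFunctionGWild := K2E3EPFunctionGWild.epFunctionGWild` is `type_of%`-exact).

WHAT.  For a CM field `L`, a finite place `v` of `L⁺` that is non-split AND RAMIFIED in `L` (`w ∣ v`, `e(w|v) ≠ 1`) with `|2|_w < 1` (a DYADIC, wildly ramified place),
every Haar measure `νQv` on `G_v = U(Φ₃)(L⁺_v)` and every family `mQv` canonical for (`IsRegularElt`, `νQv`), there is `f_G ∈ C_c^∞(G_v)` —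
`f_G := νQv(K₀)⁻¹𝟙_{K₀} + νQv(K₁)⁻¹𝟙_{K₁} − νQv(I)⁻¹𝟙_I` for the two (special) vertex stabilisers `K₀ = G_v ∩ GL₃(𝒪_w)`, `K₁ = G_v ∩ g₁GL₃(𝒪_w)g₁⁻¹` (`g₁ = diag(1,1,ϖ)`,
`ϖ` ANY uniformiser of `L_w`) and the Iwahori `I = K₀ ⊓ K₁` of the `(q+1)`-regular lattice tree of `U(3)` at `w`, pulled back along ★ `localNonsplitEquiv` — measurable,
integrable, of MASS ONE, with `f_G(1)` REAL NEGATIVE, canonical orbital integral `1` at every regular class with COMPACT centraliser and `0` at every regular class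
with NON-compact centraliser.

HOW (re-lettering of ★ (G3)-RAM-TAME `exists_epFunction_G_of_ramified` over Track A's WILD LATTICE TREE, unit U0 of «(D-RAM) FOUR-FRAME», every input ★ BY NAME).
The tame block `(ϖ, σ_w ϖ = −ϖ, hres, |2|_w = 1, hnorm)` of ★ `ramifiedBlock_adicCompletion` is NOT available at a dyadic place (no uniformiser with `σ_w ϖ = −ϖ` when
`L_w = L⁺_v(√u)`, `u` a unit; one-units of `L⁺_v` are not all norms); it is replaced by the RAMIFIED QUADRATIC DATUM `IsRamifiedQuadraticDatum σ_w ϖ d t` of ★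
`F0P3cDyRamWildPlaceDatum.exists_isRamifiedQuadraticDatum_of_placesOver` (ANY uniformiser `ϖ`, ★ `valuation_exists_uniformizer`; `d` = the different number, `|2|_w = |ϖ|^t`),
which carries no parity ∕ tameness condition, and the four tree inputs are read at the datum:
(E) `hE` := ★ EULER-G-WILD `fixedSet_subtree_of_isRamifiedQuadraticDatum` (U0 `stub_U0_fixedSet_subtree`, p854681); value at one: ★ `index_inf_subgroupOf_eq_of_isRamifiedQuadraticDatum`
(U0 `stub_U0_iwahoriIndex_wild`, p854731: `[K₀ : I] = [K₁ : I] = q + 1`, `q = |𝓀_w|`) + ★ `measureReal_coe_eq_index_mul` + ★ §1 `epValueAtOne_neg_of_ramified`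
(`νQv(I)⁻¹(2∕(q+1) − 1) < 0`, `q ≥ 2`); (N) := ★ THEOREM C₃ FOR ANY INVOLUTION `epCombination_classOrbitalIntegral_eq_zero_of_latticeModel_three_of_transitive` with its three
transitivity binders discharged at the datum — (A) ★ htr₀-WILD `exists_unitary_mapGL_stdLattice_eq_of_isSelfDualLattice_of_ramified` (p854568), (B) ★ htr₂-WILD
`htr₂_of_isRamifiedQuadraticDatum` (p854580), (I) ★ `flagTransitive_of_isRamifiedQuadraticDatum` (p854659) — and the split-torus kit (T1) := ★ (G3)-RAM §0
`exists_conj_coe_localNonsplitEquiv_eq_diagonal_of_not_isCompact_centralizer_of_v` (any uniformiser), (T2) := ★ `exists_splitTorus_generator_local_of_nonsplit_three_of_involution`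
(`e τ = diag(ϖ⁻¹, 1, σ_w ϖ)`, any involution); ★ GLUE `classOrbitalIntegral_epCombination_eq(_of_compactSpace)`, ★ `isLocSmooth_epCombination`, the compact-open levels ★
`UnitaryLatticeTree.isOpen_∕isCompact_…glInt…subgroupOf` UNCHANGED from ★ (G3).  The dyadic fence `|2|_w < 1` is carried as the socket states it but is NOT used: the datum road
is uniform in the residue characteristic (it re-proves the tame ramified case as well).

* §1 **`epFunctionGWild`** — the socket's statement, PAID.
HONEST LABEL: count-neutral helper (`--supports 24833 --as helper`); it pays socket #21 of the E3 sigs table (the EP road's (G3) at WILD places, junction Track A LH4) and widens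
the tree's EP-G column (★ `exists_isPseudoCoeff_stG_of_epFunction`, ★ `F0P3cStCharTSEPPseudoCoeffStLetters`, ★ `…KOrthWildOfEP`) to dyadic ramified places; h413 OPEN;
HC_CM is proved only modulo the 7 printed citations (2 remaining named inputs: hLiu418 = `stmt-HodgeConjecture-24832`, h413 = `stmt-HodgeConjecture-24833`) until rung 0 closes.

## References
* [Kottwitz1988] R. E. Kottwitz, *Tamagawa numbers*, Ann. of Math. 127 (1988), §2 Theorem 2 (Euler–Poincaré functions on a `p`-adic reductive group, no tameness hypothesis;
  rank one: `Φ(γ, f_EP) = χ(𝒯^γ)`).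
* [Rogawski1990] J. D. Rogawski, *Automorphic Representations of Unitary Groups in Three Variables* (1990), §12.6 p. 187 (pseudo-coefficients), §12.3 p. 176, §3.6 pp. 28–31.
* [Tits1979] J. Tits, *Reductive groups over local fields*, PSPM 33.1 (1979), §2.7 (p. 48), §2.10 (p. 49) (rank-one groups: the building is a tree; the ramified `SU₃`∕`U₃`).
* [BruhatTits1972] F. Bruhat, J. Tits, *Groupes réductifs sur un corps local I*, Publ. Math. IHÉS 41 (1972), §10 (lattice models; vertex stabilisers).
* [Serre1980Trees] J.-P. Serre, *Trees* (1980), I.6.1, I.6.4, II.1.1–1.3.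
* [Laumon1995] G. Laumon, *Cohomology of Drinfeld Modular Varieties* I (1996), Lemma (5.3.2) p. 136.
-/

set_option autoImplicit false
-- the mandated namespace has the single-problem summit's repeated segment (`HodgeConjecture.HodgeConjecture`)
set_option linter.dupNamespace false

noncomputable section

open NumberField IsDedekindDomain MeasureTheory Topology
open scoped Matrix MatrixGroups Valued
open Literature.NumberTheory.Rogawski1990 Literature.NumberTheory.Automorphic Literature.NumberTheory.Automorphic.UnitaryGroup
open Literature.NumberTheory.Automorphic.UnitaryThreeFourFrame
open Literature.NumberTheory.GaloisRepresentations
open Summit.HodgeConjecture.HodgeConjecture.Cruxes.H413.F0P3cStCharTSTorusDefs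
open Summit.HodgeConjecture.HodgeConjecture.Cruxes.H413.F0P3cStCharTSEPGlueG
open Summit.HodgeConjecture.HodgeConjecture.Cruxes.H413.F0P3cStCharTSEPGlueGRamified
open Summit.HodgeConjecture.HodgeConjecture.Cruxes.H413.F0P3cDyRamWildPlaceDatum
open Summit.HodgeConjecture.HodgeConjecture.Cruxes.H413.F0P3cDyRamWildTransitivity

namespace Summit.HodgeConjecture.HodgeConjecture.Cruxes.H413.K2E3EPFunctionGWild

/-! ## §1 Kottwitz's Euler–Poincaré function on `U(Φ₃)(L⁺_v)` at a wild place — socket `sig_K2E3EPFunctionGWild` BY NAME -/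

set_option maxHeartbeats 1600000 in  -- statement-level `whnf` on the CM carriers + eight clauses, the budget line of the socket itself and of the ★ tame twin `exists_epFunction_G_of_ramified`
set_option synthInstance.maxHeartbeats 400000 in  -- idem (the socket's own budget line)
/-- **(G3) «EP-G» AT A WILD PLACE — KOTTWITZ'S EULER–POINCARÉ FUNCTION ON `G_v = U(Φ₃)(L⁺_v)`** (`v` non-split and RAMIFIED in `L`: `e(w|v) ≠ 1`, DYADIC: `|2|_w < 1`): for every
Haar measure `νQv` and every family `mQv` canonical for (`IsRegularElt`, `νQv`) there is `f_G : G_v → ℂ`, locally constant with compact support, measurable, integrable, with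
`∫ f_G dνQv = 1`, whose value at `1` is the REAL NEGATIVE number `νQv(K₀)⁻¹ + νQv(K₁)⁻¹ − νQv(I)⁻¹`, and whose canonical orbital integral is `1` at every regular class with
COMPACT centraliser and `0` at every regular class with NON-compact centraliser (`f_G := νQv(K₀)⁻¹𝟙_{K₀} + νQv(K₁)⁻¹𝟙_{K₁} − νQv(I)⁻¹𝟙_I`, `K₀`∕`K₁` the two vertex stabilisers
and `I` the Iwahori of the wild `U(3)` tree pulled back along ★ `localNonsplitEquiv`).  The statement is socket `sig_K2E3EPFunctionGWild` BY NAME (its `Pl L` inlined); EP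
inputs BY NAME: ★ `classOrbitalIntegral_epCombination_eq(_of_compactSpace)`, ★ `index_inf_subgroupOf_eq_of_isRamifiedQuadraticDatum`, ★ EULER-G-WILD
`fixedSet_subtree_of_isRamifiedQuadraticDatum`, ★ THEOREM C₃ `…_of_latticeModel_three_of_transitive` over ★ htr₀-WILD ∕ htr₂-WILD ∕ wild flags, kit (T1) := ★ §0 of (G3)-RAM,
(T2) := ★ `exists_splitTorus_generator_local_of_nonsplit_three_of_involution`, the datum ★ `exists_isRamifiedQuadraticDatum_of_placesOver` at any uniformiser.
[cite: Kottwitz1988, §2 Theorem 2] [cite: Rogawski1990, §12.6 p. 187] [cite: Tits1979, §2.7 (p. 48)] [cite: BruhatTits1972, §10] [cite: Serre1980Trees, II.1.1] -/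
theorem epFunctionGWild :
  ∀ (L : Type) [Field L] [NumberField L] [IsCMField L] (v : HeightOneSpectrum (𝓞 ↥(maximalRealSubfield L))),
    (∀ w : PlacesOver L v, IsCMField.complexConj L • w.1 = w.1) →
    ∀ (w : PlacesOver L v), v.asIdeal.ramificationIdx' w.1.asIdeal ≠ 1 → Valued.v (2 : w.1.adicCompletion L) < 1 →
    ∀ [MeasurableSpace (Gqs L v)] [BorelSpace (Gqs L v)]
      [∀ γ : Gqs L v, MeasurableSpace (Gqs L v ⧸ Subgroup.centralizer ({γ} : Set (Gqs L v)))]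
      [∀ γ : Gqs L v, BorelSpace (Gqs L v ⧸ Subgroup.centralizer ({γ} : Set (Gqs L v)))]
      (νQv : Measure (Gqs L v)) [νQv.IsHaarMeasure] [νQv.IsMulRightInvariant]
      (mQv : OrbitalMeasureFamily (Gqs L v)),
      mQv.IsCanonical (fun γ => IsRegularElt (γ.val : GL (Fin 3) (UnitaryGroup.LocalRing L v))) νQv →
    ∃ fG : Gqs L v → ℂ, IsLocSmooth fG ∧ Measurable fG ∧ Integrable fG νQv ∧ ∫ g, fG g ∂νQv = 1 ∧
      (fG 1).im = 0 ∧ (fG 1).re < 0 ∧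
      (∀ γ : Gqs L v, IsRegularElt (γ.val : GL (Fin 3) (UnitaryGroup.LocalRing L v)) →
        IsCompact ((Subgroup.centralizer ({γ} : Set (Gqs L v))) : Set (Gqs L v)) → classOrbitalIntegral mQv fG (ConjClasses.mk γ) = 1) ∧
      (∀ γ : Gqs L v, IsRegularElt (γ.val : GL (Fin 3) (UnitaryGroup.LocalRing L v)) →
        ¬ IsCompact ((Subgroup.centralizer ({γ} : Set (Gqs L v))) : Set (Gqs L v)) → classOrbitalIntegral mQv fG (ConjClasses.mk γ) = 0) := by
  intro L _ _ _ v hns w he _h2w _ _ _ _ νQv _ _ mQv hcanQ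
  classical
  have hw : IsCMField.complexConj L • w.1 = w.1 := hns w
  have hc1 : IsCMField.complexConj L ≠ 1 := IsCMField.complexConj_ne_one L
  haveI : Algebra.IsQuadraticExtension ↥(maximalRealSubfield L) L := IsCMField.isQuadraticExtension L
  have hHf : ((qsForm L).map (cmConjRingHom L))ᵀ = qsForm L := UnitaryGroup.antidiagOne_isHermitian L 3
  have hdetf : (qsForm L).det ≠ 0 := (UnitaryGroup.isUnit_antidiagOne_det L 3).ne_zero
  letI : Fintype 𝓀[w.1.adicCompletion L] := Fintype.ofFinite _
  -- a uniformiser `ϖ` of `L_w` (ANY; at a wild place there is no `σ_w`-anti-invariant one) and the ramified quadratic datum it carries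
  obtain ⟨π, hπ⟩ := w.1.valuation_exists_uniformizer L
  have hϖv : Valued.v (π : w.1.adicCompletion L) = WithZero.exp (-1 : ℤ) := by
    rw [HeightOneSpectrum.valuedAdicCompletion_eq_valuation', hπ]
  obtain ⟨d, t, hD⟩ := exists_isRamifiedQuadraticDatum_of_placesOver L w hw he (π : w.1.adicCompletion L) hϖv
  set ϖ : w.1.adicCompletion L := (π : w.1.adicCompletion L) with hϖdef
  set σ := galAdicCompletionMap (L := L) (IsCMField.complexConj L) hw with hσdef
  have hσσ : ∀ x : w.1.adicCompletion L, σ (σ x) = x := galAdicCompletionMap_galAdicCompletionMap_of_smul_eq (IsCMField.complexConj L) w hc1 hw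
  have hvσ : ∀ x : w.1.adicCompletion L, Valued.v (σ x) = Valued.v x := fun x => valued_galAdicCompletionMap (L := L) (IsCMField.complexConj L) hw x
  set eU := localNonsplitEquiv (IsCMField.complexConj L) (qsForm L) hc1 w hw with heUdef
  -- the three levels, pulled back to `G_v`
  have hϖ0 : ϖ ≠ 0 := fun h0 => by have hv := hϖv; rw [h0, map_zero] at hv; exact WithZero.zero_ne_coe hv
  set g₁ : GL (Fin 3) (w.1.adicCompletion L) :=
    glDiagonal 3 (w.1.adicCompletion L) ![1, 1, Units.mk0 ϖ hϖ0] with hg₁def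
  have hg₁ : (g₁ : Matrix (Fin 3) (Fin 3) (w.1.adicCompletion L)) = Matrix.diagonal ![(1 : w.1.adicCompletion L), 1, ϖ] := by
    rw [hg₁def, coe_glDiagonal]
    congr 1
    funext i
    fin_cases i <;> rfl
  -- re-read the one-place model on the literal form `Φ₃ = antidiag(1,1,1)` (the `StdForm` currency of the lattice-tree files)
  have hJw : placeForm (qsForm L) w.1 = (StdForm.antidiagonal 3).over (w.1.adicCompletion L) := by
    rw [placeForm, qsForm, antidiagOne_eq_over, StdForm.over_map]
  set UA := unitaryGroupOfForm σ ((StdForm.antidiagonal 3).over (w.1.adicCompletion L)) with hUAdef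
  obtain ⟨eA, heA⟩ : ∃ eA : Gqs L v ≃ₜ* ↥UA, ∀ g : Gqs L v, ((eA g : ↥UA) : GL (Fin 3) (w.1.adicCompletion L)) =
      ((eU g : ↥(unitaryGroupOfForm σ (placeForm (qsForm L) w.1))) : GL (Fin 3) (w.1.adicCompletion L)) := by
    rw [hUAdef, ← hJw]
    exact ⟨eU, fun g => rfl⟩
  haveI hTG : IsTopologicalGroup ↥UA := inferInstance
  set K0w : Subgroup ↥UA := (glInt 3 (w.1.adicCompletion L)).subgroupOf UA with hK0wdef
  set K1w : Subgroup ↥UA := ((glInt 3 (w.1.adicCompletion L)).map (MulAut.conj g₁).toMonoidHom).subgroupOf UA with hK1wdef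
  set K0 : Subgroup (Gqs L v) := K0w.comap eA.toMulEquiv.toMonoidHom with hK0def
  set K1 : Subgroup (Gqs L v) := K1w.comap eA.toMulEquiv.toMonoidHom with hK1def
  set I : Subgroup (Gqs L v) := (K0w ⊓ K1w).comap eA.toMulEquiv.toMonoidHom with hIdef
  -- compact-open (★ (G0) §2 on `UA`, pulled back along the homeomorphism `eA`)
  have hσc : Continuous σ := continuous_galAdicCompletionMap L (IsCMField.complexConj L) hw
  haveI := compactSpace_integer_adicCompletion L w.1
  have hpre : ∀ C : Subgroup ↥UA, ((C.comap eA.toMulEquiv.toMonoidHom : Subgroup (Gqs L v)) : Set (Gqs L v)) = eA ⁻¹' (C : Set ↥UA) := fun _ => rfl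
  have hK0o : IsOpen (K0 : Set (Gqs L v)) := by
    rw [hK0def, hpre]; exact (UnitaryLatticeTree.isOpen_glInt_subgroupOf σ _).preimage eA.continuous
  have hK0c : IsCompact (K0 : Set (Gqs L v)) := by
    rw [hK0def, hpre]; exact eA.toHomeomorph.isCompact_preimage.2 (UnitaryLatticeTree.isCompact_glInt_subgroupOf σ _ hσc)
  have hK1o : IsOpen (K1 : Set (Gqs L v)) := by
    rw [hK1def, hpre]; exact (UnitaryLatticeTree.isOpen_conj_glInt_subgroupOf σ _ g₁).preimage eA.continuous
  have hK1c : IsCompact (K1 : Set (Gqs L v)) := by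
    rw [hK1def, hpre]; exact eA.toHomeomorph.isCompact_preimage.2 (UnitaryLatticeTree.isCompact_conj_glInt_subgroupOf σ _ g₁ hσc)
  have hIo : IsOpen (I : Set (Gqs L v)) := by
    rw [hIdef, hpre]; exact (UnitaryLatticeTree.isOpen_glInt_inf_conj_glInt_subgroupOf σ _ g₁).preimage eA.continuous
  have hIc : IsCompact (I : Set (Gqs L v)) := by
    rw [hIdef, hpre]; exact eA.toHomeomorph.isCompact_preimage.2 (UnitaryLatticeTree.isCompact_glInt_inf_conj_glInt_subgroupOf σ _ g₁ hσc)
  -- volumes of compact open subgroups are finite and positive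
  have hvol : ∀ S : Subgroup (Gqs L v), IsOpen (S : Set (Gqs L v)) → IsCompact (S : Set (Gqs L v)) → (((νQv S).toReal : ℂ)) ≠ 0 := by
    intro S hSo hSc
    have hpos : 0 < νQv S := hSo.measure_pos νQv ⟨1, S.one_mem⟩
    exact_mod_cast (ENNReal.toReal_pos hpos.ne' hSc.measure_lt_top.ne).ne'
  have hint : ∀ S : Subgroup (Gqs L v), IsOpen (S : Set (Gqs L v)) → IsCompact (S : Set (Gqs L v)) → ∀ c : ℂ,
      Integrable (fun g => c * (S : Set (Gqs L v)).indicator (fun _ => (1 : ℂ)) g) νQv := fun S hSo hSc c =>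
    (((isLocSmooth_indicator_subgroup S hSo hSc).continuous.integrable_of_hasCompactSupport
      (isLocSmooth_indicator_subgroup S hSo hSc).hasCompactSupport)).const_mul c
  have hintv : ∀ S : Subgroup (Gqs L v), IsOpen (S : Set (Gqs L v)) → ∀ c : ℂ,
      ∫ g, c * (S : Set (Gqs L v)).indicator (fun _ => (1 : ℂ)) g ∂νQv = c * ((νQv S).toReal : ℂ) := by
    intro S hSo c
    rw [integral_const_mul, integral_indicator_const (1 : ℂ) hSo.measurableSet, Complex.real_smul, mul_one]
    rfl
  -- Kottwitz's function
  set fG : Gqs L v → ℂ := fun g => (((νQv K0).toReal : ℂ))⁻¹ * (K0 : Set (Gqs L v)).indicator (fun _ => (1 : ℂ)) g +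
      (((νQv K1).toReal : ℂ))⁻¹ * (K1 : Set (Gqs L v)).indicator (fun _ => (1 : ℂ)) g -
      (((νQv I).toReal : ℂ))⁻¹ * (I : Set (Gqs L v)).indicator (fun _ => (1 : ℂ)) g with hfGdef
  have hsmooth : IsLocSmooth fG := isLocSmooth_epCombination K0 K1 I hK0o hK0c hK1o hK1c hIo hIc _ _ _
  have iK0 := hint K0 hK0o hK0c ((((νQv K0).toReal : ℂ))⁻¹)
  have iK1 := hint K1 hK1o hK1c ((((νQv K1).toReal : ℂ))⁻¹)
  have iI := hint I hIo hIc ((((νQv I).toReal : ℂ))⁻¹)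
  have hfG1 : fG 1 = (((νQv K0).toReal : ℂ))⁻¹ + (((νQv K1).toReal : ℂ))⁻¹ - (((νQv I).toReal : ℂ))⁻¹ := by
    simp only [hfGdef, Set.indicator_of_mem (SetLike.mem_coe.2 K0.one_mem), Set.indicator_of_mem (SetLike.mem_coe.2 K1.one_mem),
      Set.indicator_of_mem (SetLike.mem_coe.2 I.one_mem), mul_one]
  have hfG1re : (fG 1).re = ((νQv K0).toReal)⁻¹ + ((νQv K1).toReal)⁻¹ - ((νQv I).toReal)⁻¹ := by
    rw [hfG1, ← Complex.ofReal_inv, ← Complex.ofReal_inv, ← Complex.ofReal_inv, ← Complex.ofReal_add, ← Complex.ofReal_sub, Complex.ofReal_re]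
  refine ⟨fG, hsmooth, hsmooth.continuous.measurable, (iK0.add iK1).sub iI, ?_, ?_, ?_, ?_, ?_⟩
  · -- mass one
    have h1 : ∫ g, fG g ∂νQv = (∫ g, (((νQv K0).toReal : ℂ))⁻¹ * (K0 : Set (Gqs L v)).indicator (fun _ => (1 : ℂ)) g ∂νQv +
        ∫ g, (((νQv K1).toReal : ℂ))⁻¹ * (K1 : Set (Gqs L v)).indicator (fun _ => (1 : ℂ)) g ∂νQv) -
        ∫ g, (((νQv I).toReal : ℂ))⁻¹ * (I : Set (Gqs L v)).indicator (fun _ => (1 : ℂ)) g ∂νQv := by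
      have h := integral_sub (μ := νQv)
        (f := fun g => (((νQv K0).toReal : ℂ))⁻¹ * (K0 : Set (Gqs L v)).indicator (fun _ => (1 : ℂ)) g +
          (((νQv K1).toReal : ℂ))⁻¹ * (K1 : Set (Gqs L v)).indicator (fun _ => (1 : ℂ)) g)
        (g := fun g => (((νQv I).toReal : ℂ))⁻¹ * (I : Set (Gqs L v)).indicator (fun _ => (1 : ℂ)) g) (iK0.add iK1) iI
      rw [integral_add iK0 iK1] at h
      exact h
    rw [h1, hintv K0 hK0o, hintv K1 hK1o, hintv I hIo, inv_mul_cancel₀ (hvol K0 hK0o hK0c), inv_mul_cancel₀ (hvol K1 hK1o hK1c),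
      inv_mul_cancel₀ (hvol I hIo hIc)]
    norm_num
  · -- `fG 1` is real
    rw [hfG1, ← Complex.ofReal_inv, ← Complex.ofReal_inv, ← Complex.ofReal_inv, ← Complex.ofReal_add, ← Complex.ofReal_sub, Complex.ofReal_im]
  · -- `fG 1 < 0` (from the wild-tree indices `q + 1`, `q + 1` of ★ `index_inf_subgroupOf_eq_of_isRamifiedQuadraticDatum` (U0 `stub_U0_iwahoriIndex_wild`), transported along `eA`; ★ §1 sign lemma)
    have hidx := UnitaryLatticeTree.index_inf_subgroupOf_eq_of_isRamifiedQuadraticDatum σ ϖ d t hD g₁ hg₁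
    have h0 : (I.subgroupOf K0).index = Nat.card 𝓀[w.1.adicCompletion L] + 1 := by
      rw [hIdef, hK0def, index_subgroupOf_comap_mulEquiv]; exact hidx.1
    have h1 : (I.subgroupOf K1).index = Nat.card 𝓀[w.1.adicCompletion L] + 1 := by
      rw [hIdef, hK1def, index_subgroupOf_comap_mulEquiv]; exact hidx.2
    haveI : (I.subgroupOf K0).FiniteIndex := ⟨by rw [h0]; exact Nat.succ_ne_zero _⟩
    haveI : (I.subgroupOf K1).FiniteIndex := ⟨by rw [h1]; exact Nat.succ_ne_zero _⟩
    have hq2 : 2 ≤ Nat.card 𝓀[w.1.adicCompletion L] := Finite.one_lt_card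
    have hmpos : 0 < (νQv I).toReal :=
      ENNReal.toReal_pos (hIo.measure_pos νQv ⟨1, I.one_mem⟩).ne' hIc.measure_lt_top.ne
    have ha : (νQv K0).toReal = ((Nat.card 𝓀[w.1.adicCompletion L] : ℝ) + 1) * (νQv I).toReal := by
      have h := UnitaryLatticeTree.measureReal_coe_eq_index_mul νQv (Subgroup.comap_mono inf_le_left : I ≤ K0) hIo
      rw [h0, measureReal_def, measureReal_def] at h
      rw [h]; push_cast; ring
    have hb : (νQv K1).toReal = ((Nat.card 𝓀[w.1.adicCompletion L] : ℝ) + 1) * (νQv I).toReal := by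
      have h := UnitaryLatticeTree.measureReal_coe_eq_index_mul νQv (Subgroup.comap_mono inf_le_right : I ≤ K1) hIo
      rw [h1, measureReal_def, measureReal_def] at h
      rw [h]; push_cast; ring
    rw [hfG1re]
    exact epValueAtOne_neg_of_ramified hmpos hq2 ha hb
  · -- elliptic regular classes: (E) = ★ EULER-G-WILD on `UA`, finiteness from the compact centraliser and the closed regular class, counts transported along `eA`
    intro γ hreg hZc
    haveI : CompactSpace (Subgroup.centralizer ({γ} : Set (Gqs L v))) := isCompact_iff_compactSpace.1 hZc
    have hO := UnitaryGroup.isClosed_conjClass_local_of_isRegularElt L 3 (qsForm L) v hHf hdetf γ hreg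
    -- finiteness of the fixed sets, proved on `G_v` and moved to `UA`
    have hfin : ∀ C : Subgroup ↥UA, IsOpen ((C.comap eA.toMulEquiv.toMonoidHom : Subgroup (Gqs L v)) : Set (Gqs L v)) →
        IsCompact ((C.comap eA.toMulEquiv.toMonoidHom : Subgroup (Gqs L v)) : Set (Gqs L v)) → (MulAction.fixedBy (↥UA ⧸ C) (eA γ)).Finite := by
      intro C hCo hCc
      haveI := (finite_fixedBy_quotient_of_isClosed γ (C.comap eA.toMulEquiv.toMonoidHom) hO hCo hCc).to_subtype
      obtain ⟨Φ, -⟩ := exists_equiv_fixedBy_quotient_congr (C.comap eA.toMulEquiv.toMonoidHom) C eA.toMulEquiv (fun g => Iff.rfl) γ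
      exact Set.finite_coe_iff.1 (Finite.of_equiv _ Φ)
    -- the centraliser of `eA γ` in `UA` is the (compact) image of `Z(γ)`
    have hZeq : ((Subgroup.centralizer ({eA γ} : Set ↥UA)) : Set ↥UA) = eA '' ((Subgroup.centralizer ({γ} : Set (Gqs L v))) : Set (Gqs L v)) := by
      ext u
      simp only [SetLike.mem_coe, Subgroup.mem_centralizer_singleton_iff, Set.mem_image]
      constructor
      · intro hu
        refine ⟨eA.symm u, ?_, eA.apply_symm_apply u⟩
        apply eA.injective
        rw [map_mul, map_mul, eA.apply_symm_apply]
        exact hu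
      · rintro ⟨g, hg, rfl⟩
        rw [← map_mul, ← map_mul, hg]
    have hZc' : IsCompact ((Subgroup.centralizer ({eA γ} : Set ↥UA)) : Set ↥UA) := by
      rw [hZeq]; exact hZc.image eA.continuous
    haveI : CompactSpace (Subgroup.centralizer ({eA γ} : Set ↥UA)) := isCompact_iff_compactSpace.1 hZc'
    have hK0wo : IsOpen (K0w : Set ↥UA) := by
      rw [hK0wdef]; exact UnitaryLatticeTree.isOpen_glInt_subgroupOf σ ((StdForm.antidiagonal 3).over (w.1.adicCompletion L))
    have horb := finite_range_pow_quotient_of_isOpen (G := ↥UA) (eA γ) K0w hK0wo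
    have hE := UnitaryLatticeTree.fixedSet_subtree_of_isRamifiedQuadraticDatum σ ϖ d t hD g₁ hg₁ (eA γ) (hfin K0w hK0o hK0c) (hfin K1w hK1o hK1c) horb
    rw [hfGdef, classOrbitalIntegral_epCombination_eq_of_compactSpace L 3 (qsForm L) v νQv hHf hdetf hcanQ K0 K1 I hK0o hK0c hK1o hK1c hIo hIc γ hreg,
      natCard_fixedBy_quotient_congr K0 K0w eA.toMulEquiv (fun g => Iff.rfl) γ, natCard_fixedBy_quotient_congr K1 K1w eA.toMulEquiv (fun g => Iff.rfl) γ,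
      natCard_fixedBy_quotient_congr I (K0w ⊓ K1w) eA.toMulEquiv (fun g => Iff.rfl) γ]
    have hE' : (Nat.card (MulAction.fixedBy (↥UA ⧸ K0w) (eA.toMulEquiv γ)) : ℂ) + (Nat.card (MulAction.fixedBy (↥UA ⧸ K1w) (eA.toMulEquiv γ)) : ℂ) =
        (Nat.card (MulAction.fixedBy (↥UA ⧸ (K0w ⊓ K1w)) (eA.toMulEquiv γ)) : ℂ) + 1 := by exact_mod_cast hE
    rw [hE', add_sub_cancel_left]
  · -- non-elliptic regular classes: (N) = ★ THEOREM C₃ for any involution, (A)(B)(I) discharged on the wild tree, kit (T1) := ★ §0 of (G3)-RAM and (T2) := ★ (T2)-RAM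
    intro γ hreg hZnc
    -- the three levels by membership through `eU`
    have hmem : ∀ (C : Subgroup (GL (Fin 3) (w.1.adicCompletion L))) (g : Gqs L v),
        g ∈ ((C.subgroupOf UA).comap eA.toMulEquiv.toMonoidHom : Subgroup (Gqs L v)) ↔
          ((eU g : ↥(unitaryGroupOfForm σ (placeForm (qsForm L) w.1))) : GL (Fin 3) (w.1.adicCompletion L)) ∈ C := by
      intro C g
      rw [Subgroup.mem_comap, Subgroup.mem_subgroupOf, ← heA g]
      rfl
    have hImem : ∀ g : Gqs L v, g ∈ I ↔
        ((eU g : ↥(unitaryGroupOfForm σ (placeForm (qsForm L) w.1))) : GL (Fin 3) (w.1.adicCompletion L)) ∈ glInt 3 (w.1.adicCompletion L) ∧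
          ((eU g : ↥(unitaryGroupOfForm σ (placeForm (qsForm L) w.1))) : GL (Fin 3) (w.1.adicCompletion L)) ∈
            (glInt 3 (w.1.adicCompletion L)).map (MulAut.conj g₁).toMonoidHom := by
      intro g
      rw [hIdef, Subgroup.mem_comap, Subgroup.mem_inf, hK0wdef, hK1wdef, Subgroup.mem_subgroupOf, Subgroup.mem_subgroupOf, ← heA g]
      rfl
    -- the antidiagonal shape of `(Φ₃)_w`
    have hform := TypeThreeTorus.placeForm_qsForm_eq L w
    have hJ : ∀ i j : Fin 3, j ≠ Fin.rev i → placeForm (qsForm L) w.1 i j = 0 := by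
      intro i j hij
      rw [hform]
      fin_cases i <;> fin_cases j <;> first | rfl | exact absurd (by decide) hij
    have hH₀₂ : placeForm (qsForm L) w.1 0 2 ≠ 0 := by rw [hform]; exact one_ne_zero
    have hH₁₁ : placeForm (qsForm L) w.1 1 1 ≠ 0 := by rw [hform]; exact one_ne_zero
    -- `IsRegularElt` is a class function on `G_v`
    have hP : ∀ g x : Gqs L v, IsRegularElt (g.val : GL (Fin 3) (UnitaryGroup.LocalRing L v)) →
        IsRegularElt ((x * g * x⁻¹).val : GL (Fin 3) (UnitaryGroup.LocalRing L v)) := fun g x hg => isRegularElt_val_conj L 3 _ v g x hg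
    -- (T1) := ★ §0 of (G3)-RAM at the uniformiser `ϖ` (any): a regular DIAGONAL representative `δ` of the class of `γ`, valuation profile `(|ϖ^c|, 1, |ϖ^{−c}|)`
    obtain ⟨γ', e, c, hconj, hδm', -, he₀, he₁, he₂⟩ :=
      exists_conj_coe_localNonsplitEquiv_eq_diagonal_of_not_isCompact_centralizer_of_v L v hns w hw hϖv hreg hZnc
    obtain ⟨g, hg⟩ := isConj_iff.1 hconj
    have hcl : ConjClasses.mk (g * γ * g⁻¹) = ConjClasses.mk γ := ConjClasses.mk_eq_mk_iff_isConj.2 (isConj_iff.2 ⟨g, rfl⟩).symm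
    have hδm : (((eU (g * γ * g⁻¹) : ↥(unitaryGroupOfForm σ (placeForm (qsForm L) w.1))) : GL (Fin 3) (w.1.adicCompletion L)) :
        Matrix (Fin 3) (Fin 3) (w.1.adicCompletion L)) = Matrix.diagonal e := by rw [hg]; exact hδm'
    have hregδ : IsRegularElt ((g * γ * g⁻¹).val : GL (Fin 3) (UnitaryGroup.LocalRing L v)) := isRegularElt_val_conj L 3 _ v γ g hreg
    -- (T2) := ★ (T2)-RAM `exists_splitTorus_generator_local_of_nonsplit_three_of_involution` (any involution; regularity of the diagonal from the separable characteristic polynomial)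
    haveI := isDiscreteValuationRing_integer_of_compatible hϖv
    have hsep : (Matrix.diagonal e).charpoly.Separable := by
      rw [← hδm]; exact (TypeThreeTorus.isRegularElt_iff_separable_localNonsplitEquiv L w hw _).1 hregδ
    have hinj : Function.Injective e := by
      rw [Matrix.charpoly_diagonal] at hsep; exact Polynomial.separable_prod_X_sub_C_iff.1 hsep
    obtain ⟨τ, hτm, hgen, hfree⟩ := exists_splitTorus_generator_local_of_nonsplit_three_of_involution (IsCMField.complexConj L) (qsForm L) hc1 w hw hJ hH₀₂ hH₁₁
      (isUniformizingElement_of_v_eq hϖv) hδm (fun i j hij => isUnit_iff_ne_zero.2 (sub_ne_zero.2 fun h => hij (hinj h)))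
    -- the compact-core facts and the closed class of `δ`
    obtain ⟨hcomm, hcc, hco⟩ := compactCore_centralizer_local_facts_of_isRegularElt (IsCMField.complexConj L) 3 _ hc1
      (UnitaryGroup.antidiagOne_map_transpose (IsCMField.complexConj L) 3) (isUnit_antidiagOne_det L 3) (g * γ * g⁻¹) hregδ
    have hO := UnitaryGroup.isClosed_conjClass_local_of_isRegularElt L 3 (qsForm L) v hHf hdetf (g * γ * g⁻¹) hregδ
    -- (A)(B)(I): the three transitivities of `U(σ_w, Φ₃)` on the WILD lattice tree at the datum (★ htr₀-WILD, ★ htr₂-WILD, ★ wild flags)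
    have hA : ∀ M : Submodule 𝒪[w.1.adicCompletion L] (Fin 3 → w.1.adicCompletion L),
        UnitaryLatticeTree.IsSelfDualLattice σ ϖ ((StdForm.antidiagonal 3).over (w.1.adicCompletion L)) M →
        ∃ u : ↥UA, UnitaryLatticeTree.mapGL (u : GL (Fin 3) (w.1.adicCompletion L)) (HermitianLattice.stdLattice (w.1.adicCompletion L) 3) = M := fun M hM => by
      obtain ⟨u, hu⟩ := UnitaryLatticeTree.exists_unitary_mapGL_stdLattice_eq_of_isSelfDualLattice_of_ramified
        hD.1 hD.2.1 hD.2.2.1 hD.2.2.2.1 hD.2.2.2.2.1 hD.2.2.2.2.2.1 hD.2.2.2.2.2.2 M hM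
      exact ⟨u, hu.symm⟩
    have hN₁ : UnitaryLatticeTree.mapGL g₁ (HermitianLattice.stdLattice (w.1.adicCompletion L) 3) =
        UnitaryLatticeTree.latt (Matrix.diagonal ![(1 : w.1.adicCompletion L), 1, ϖ]) := by rw [← hg₁]; rfl
    have hB : ∀ M : Submodule 𝒪[w.1.adicCompletion L] (Fin 3 → w.1.adicCompletion L),
        UnitaryLatticeTree.IsVertexLattice σ ϖ ((StdForm.antidiagonal 3).over (w.1.adicCompletion L)) 2 M →
        ∃ u : ↥UA, UnitaryLatticeTree.mapGL ((u : GL (Fin 3) (w.1.adicCompletion L)) * g₁) (HermitianLattice.stdLattice (w.1.adicCompletion L) 3) = M :=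
      fun M hM => by
      obtain ⟨u, hu⟩ := htr₂_of_isRamifiedQuadraticDatum hD M hM
      exact ⟨u, by rw [UnitaryLatticeTree.mapGL_mul, hN₁]; exact hu.symm⟩
    have hflag := UnitaryLatticeTree.flagTransitive_of_isRamifiedQuadraticDatum σ ϖ d t hD g₁ hg₁
    -- `Φ(ν(C)⁻¹ · 𝟙_C) = ν(C)⁻¹ · Φ(𝟙_C)` ×3 (★ linearity at a regular class), pass to `δ`, then ★ THEOREM C₃ on the model `e_w`
    rw [hfGdef, classOrbitalIntegral_epCombination_eq L 3 (qsForm L) v hHf hdetf hcanQ.isAdmissibleOn K0 K1 I hK0o hK0c hK1o hK1c hIo hIc _ _ _ γ hreg, ← hcl]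
    exact epCombination_classOrbitalIntegral_eq_zero_of_latticeModel_three_of_transitive hP hcanQ hσσ hvσ hϖv g₁ hg₁ hA hB hflag hJw eU.toMulEquiv K0 K1 I
      (hmem _) (hmem _) hImem hK0o hK0c hK1o hK1c hIo hIc hregδ hO hcomm hcc hco τ hgen hfree hτm hδm he₀ he₁ he₂

end Summit.HodgeConjecture.HodgeConjecture.Cruxes.H413.K2E3EPFunctionGWild

end
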